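import Mathlib
import HarnessLib

/-!
# Saturating a principal open of a Γ-scheme (crux `UniversalCells.MatroidCellRes`, line `birth`)

Stub `stub_saturateAway` of the skeleton `Cruxes/MatroidCellRes/Lines/birth.lean` for crux
stmt-ResolutionOfSingularities-15230
(`Summit.ResolutionOfSingularities.ResolutionOfSingularities.Theses.UniversalCells.MatroidCellRes`).
The coordinate ring `Q_{Γ₀} = 𝔽_p[a_ij : 3 × m] ⧸ (3 × 3 minors of [I₃ | A] indexed by Γ₀)`
of the Γ-scheme `Z_{Γ₀}` is written out over Mathlib exactly as in the registered signature (the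
two `let`s of the crux, substituted).

Proof idea (pure commutative algebra, "localisation commutes with quotients"): put
`L := (Q_{Γ₀})_f` and `Γ := {u | x_u = 0 in L} ⊇ Γ₀`. Then `I_{Γ₀} ≤ I_Γ`, so there is
the projection `π : Q_{Γ₀} → Q_Γ`; put `g := π f`. The universal properties of the localisations
`L = (Q_{Γ₀})_f`, `(Q_Γ)_g` and of the quotient `Q_Γ` give mutually inverse ring maps
`L ⇄ (Q_Γ)_g` (the extra generators `x_u`, `u ∈ Γ`, of `I_Γ` are already `0` in `L`), whence
`(Q_Γ)_g ≃+* L` is a domain, and for `u ∉ Γ` the image of `x_u` in `(Q_Γ)_g` maps to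
`x_u ≠ 0` in `L`, so it is non-zero. The argument is carried out for an arbitrary family
`x : ι → P` in a commutative ring `P` (`saturateAway_of_family`) and then specialised.
-/

noncomputable section

-- single-problem summit: the doubled namespace component `ResolutionOfSingularities` is forced
set_option linter.dupNamespace false

open CategoryTheory AlgebraicGeometry

namespace Summit.ResolutionOfSingularities.ResolutionOfSingularities.Theorems.MatroidCellRes

/-- **Saturation of a principal open, for an arbitrary family of generators**: let `P` be a
commutative ring, `x : ι → P` a family, `Γ₀ ⊆ ι`, and `f ∈ P ⧸ (x '' Γ₀)` with
`L := (P ⧸ (x '' Γ₀))_f` a domain. With `Γ := {u | x_u = 0 in L} ⊇ Γ₀` and `g` the image of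
`f` in `P ⧸ (x '' Γ)`, localisation commutes with quotients: `L ≃+* (P ⧸ (x '' Γ))_g` (the extra
generators are already `0` in `L`); hence `(P ⧸ (x '' Γ))_g` is a domain and, for `u ∉ Γ`, the
image of `x_u` in it is non-zero (it maps to `x_u ≠ 0` in `L`). [folklore] -/
theorem saturateAway_of_family {P : Type*} [CommRing P] {ι : Type*} (x : ι → P) (Γ0 : Set ι)
    (f : P ⧸ Ideal.span (x '' Γ0)) [IsDomain (Localization.Away f)] :
    ∃ (Γ : Set ι) (g : P ⧸ Ideal.span (x '' Γ))
      (_ : Localization.Away f ≃+* Localization.Away g),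
      IsDomain (Localization.Away g) ∧
        ∀ u : ι, u ∉ Γ →
          algebraMap (P ⧸ Ideal.span (x '' Γ)) (Localization.Away g)
            (Ideal.Quotient.mk (Ideal.span (x '' Γ)) (x u)) ≠ 0 := by
  -- the saturated set `Γ ⊇ Γ0` and the projection `π : P ⧸ (x '' Γ0) → P ⧸ (x '' Γ)`
  set Γ : Set ι := {u | algebraMap (P ⧸ Ideal.span (x '' Γ0)) (Localization.Away f)
    (Ideal.Quotient.mk (Ideal.span (x '' Γ0)) (x u)) = 0} with hΓ
  have hle : Ideal.span (x '' Γ0) ≤ Ideal.span (x '' Γ) := by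
    refine Ideal.span_mono (Set.image_mono fun u hu => ?_)
    rw [hΓ, Set.mem_setOf_eq,
      Ideal.Quotient.eq_zero_iff_mem.mpr (Ideal.subset_span (Set.mem_image_of_mem x hu)), map_zero]
  obtain ⟨π, hπ⟩ : ∃ π : P ⧸ Ideal.span (x '' Γ0) →+* P ⧸ Ideal.span (x '' Γ),
      ∀ a : P, π (Ideal.Quotient.mk _ a) = Ideal.Quotient.mk _ a :=
    ⟨Ideal.Quotient.factor hle, fun a => Ideal.Quotient.factor_mk hle a⟩
  -- `ψ : P ⧸ (x '' Γ) → L`, well defined by the very definition of `Γ`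
  have hker : ∀ a ∈ Ideal.span (x '' Γ),
      ((algebraMap (P ⧸ Ideal.span (x '' Γ0)) (Localization.Away f)).comp
        (Ideal.Quotient.mk (Ideal.span (x '' Γ0)))) a = 0 := by
    intro a ha
    have hsub : Ideal.span (x '' Γ) ≤ RingHom.ker
        ((algebraMap (P ⧸ Ideal.span (x '' Γ0)) (Localization.Away f)).comp
          (Ideal.Quotient.mk (Ideal.span (x '' Γ0)))) := by
      refine Ideal.span_le.mpr ?_
      rintro _ ⟨u, hu, rfl⟩
      rw [hΓ, Set.mem_setOf_eq] at hu
      rw [SetLike.mem_coe, RingHom.mem_ker, RingHom.comp_apply]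
      exact hu
    exact hsub ha
  obtain ⟨ψ, hψ⟩ : ∃ ψ : P ⧸ Ideal.span (x '' Γ) →+* Localization.Away f,
      ∀ a : P, ψ (Ideal.Quotient.mk _ a) =
        algebraMap (P ⧸ Ideal.span (x '' Γ0)) (Localization.Away f) (Ideal.Quotient.mk _ a) :=
    ⟨Ideal.Quotient.lift _ _ hker, fun a => Ideal.Quotient.lift_mk _ _ hker⟩
  have hψπ : ∀ b : P ⧸ Ideal.span (x '' Γ0),
      ψ (π b) = algebraMap (P ⧸ Ideal.span (x '' Γ0)) (Localization.Away f) b := by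
    intro b
    obtain ⟨a, rfl⟩ := Ideal.Quotient.mk_surjective b
    rw [hπ, hψ]
  -- `g := π f`; the comparison maps `α : L → (P ⧸ (x '' Γ))_g` and `β` back
  refine ⟨Γ, π f, ?_⟩
  have hunitα :
      IsUnit (((algebraMap (P ⧸ Ideal.span (x '' Γ)) (Localization.Away (π f))).comp π) f) :=
    IsLocalization.Away.algebraMap_isUnit (S := Localization.Away (π f)) (π f)
  obtain ⟨α, hα⟩ : ∃ α : Localization.Away f →+* Localization.Away (π f),
      ∀ b : P ⧸ Ideal.span (x '' Γ0),
        α (algebraMap (P ⧸ Ideal.span (x '' Γ0)) (Localization.Away f) b) =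
          algebraMap (P ⧸ Ideal.span (x '' Γ)) (Localization.Away (π f)) (π b) :=
    ⟨IsLocalization.Away.lift f hunitα, fun b => IsLocalization.Away.lift_eq f hunitα b⟩
  have hunitβ : IsUnit (ψ (π f)) := by
    rw [hψπ]
    exact IsLocalization.Away.algebraMap_isUnit (S := Localization.Away f) f
  obtain ⟨β, hβ⟩ : ∃ β : Localization.Away (π f) →+* Localization.Away f,
      ∀ c : P ⧸ Ideal.span (x '' Γ),
        β (algebraMap (P ⧸ Ideal.span (x '' Γ)) (Localization.Away (π f)) c) = ψ c :=
    ⟨IsLocalization.Away.lift (π f) hunitβ,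
      fun c => IsLocalization.Away.lift_eq (π f) hunitβ c⟩
  have hβα : β.comp α = RingHom.id (Localization.Away f) := by
    refine IsLocalization.ringHom_ext (Submonoid.powers f) (RingHom.ext fun b => ?_)
    rw [RingHom.comp_apply, RingHom.comp_apply, hα, hβ, hψπ, RingHom.comp_apply,
      RingHom.id_apply]
  have hαβ : α.comp β = RingHom.id (Localization.Away (π f)) := by
    refine IsLocalization.ringHom_ext (Submonoid.powers (π f))
      (Ideal.Quotient.ringHom_ext (RingHom.ext fun a => ?_))
    rw [RingHom.comp_apply, RingHom.comp_apply, RingHom.comp_apply, hβ, hψ, hα, hπ,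
      RingHom.comp_apply, RingHom.comp_apply, RingHom.id_apply]
  let e : Localization.Away f ≃+* Localization.Away (π f) :=
    RingEquiv.ofRingHom α β hαβ hβα
  haveI : IsDomain (Localization.Away (π f)) :=
    MulEquiv.isDomain (Localization.Away f) e.symm.toMulEquiv
  refine ⟨e, this, fun u hu h0 => hu ?_⟩
  -- saturation: `β` sends the image of `x u` to `x u ∈ L`, which is non-zero for `u ∉ Γ`
  rw [hΓ, Set.mem_setOf_eq, ← hψ, ← hβ, h0, map_zero]

/-- **Saturating a principal open of a Γ-scheme** (stub `stub_saturateAway` of crux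
`UniversalCells.MatroidCellRes`, line `birth`): for every `f` in the coordinate ring
`Q_{Γ₀} = 𝔽_p[a_ij : 3 × m] ⧸ (3 × 3 minors x_u of [I₃ | A], u ∈ Γ₀)` of a Γ-scheme
with `(Q_{Γ₀})_f` a domain there are a set of triples `Γ` (namely
`{u : x_u = 0 in (Q_{Γ₀})_f} ⊇ Γ₀`), an element `g : Q_Γ` (the image of `f`) and a ring
isomorphism `(Q_{Γ₀})_f ≃+* (Q_Γ)_g` (localisation commutes with quotients, and the extra
minors are already `0` in `(Q_{Γ₀})_f`), such that `(Q_Γ)_g` is a domain and `Γ` is SATURATED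
on the chart: `u ∉ Γ ⇒ x_u ≠ 0 in (Q_Γ)_g`. [folklore] -/
theorem stub_saturateAway (p m : ℕ) (Γ0 : Set (Fin 3 → Fin 3 ⊕ Fin m))
    (f : MvPolynomial (Fin 3 × Fin m) (ZMod p) ⧸ Ideal.span ((fun u : Fin 3 → Fin 3 ⊕ Fin m => ((Matrix.fromCols (1 : Matrix (Fin 3) (Fin 3) (MvPolynomial (Fin 3 × Fin m) (ZMod p))) (Matrix.of fun i j => MvPolynomial.X (i, j))).submatrix id u).det) '' Γ0))
    (hdom : IsDomain (Localization.Away f)) :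
    ∃ (Γ : Set (Fin 3 → Fin 3 ⊕ Fin m))
      (g : MvPolynomial (Fin 3 × Fin m) (ZMod p) ⧸ Ideal.span ((fun u : Fin 3 → Fin 3 ⊕ Fin m => ((Matrix.fromCols (1 : Matrix (Fin 3) (Fin 3) (MvPolynomial (Fin 3 × Fin m) (ZMod p))) (Matrix.of fun i j => MvPolynomial.X (i, j))).submatrix id u).det) '' Γ))
      (_ : Localization.Away f ≃+* Localization.Away g),
      IsDomain (Localization.Away g) ∧
        ∀ u : Fin 3 → Fin 3 ⊕ Fin m, u ∉ Γ →
          algebraMap (MvPolynomial (Fin 3 × Fin m) (ZMod p) ⧸ Ideal.span ((fun u : Fin 3 → Fin 3 ⊕ Fin m => ((Matrix.fromCols (1 : Matrix (Fin 3) (Fin 3) (MvPolynomial (Fin 3 × Fin m) (ZMod p))) (Matrix.of fun i j => MvPolynomial.X (i, j))).submatrix id u).det) '' Γ)) (Localization.Away g)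
            (Ideal.Quotient.mk (Ideal.span ((fun u : Fin 3 → Fin 3 ⊕ Fin m => ((Matrix.fromCols (1 : Matrix (Fin 3) (Fin 3) (MvPolynomial (Fin 3 × Fin m) (ZMod p))) (Matrix.of fun i j => MvPolynomial.X (i, j))).submatrix id u).det) '' Γ))
              ((Matrix.fromCols (1 : Matrix (Fin 3) (Fin 3) (MvPolynomial (Fin 3 × Fin m) (ZMod p))) (Matrix.of fun i j => MvPolynomial.X (i, j))).submatrix id u).det) ≠ 0 := by
  haveI := hdom
  exact saturateAway_of_family
    (fun u : Fin 3 → Fin 3 ⊕ Fin m => ((Matrix.fromCols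
      (1 : Matrix (Fin 3) (Fin 3) (MvPolynomial (Fin 3 × Fin m) (ZMod p)))
      (Matrix.of fun i j => MvPolynomial.X (i, j))).submatrix id u).det) Γ0 f

end Summit.ResolutionOfSingularities.ResolutionOfSingularities.Theorems.MatroidCellRes

end
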